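import Literature.NumberTheory.LFunctions.YoshidaWindowGramTailMSForms
import HarnessLib

/-!
# Kernel enclosures of Yoshida's matrix coefficients — VIII-c: boxes of the mean-square prime sums with sine data

Source: H. Yoshida, Adv. Stud. Pure Math. **21** (1992) 281–325, §§6–7 [Yoshida1992HermitianForms].  Kernel enclosures of the
prime sums entering the mean-square tail constant of part VIII-b (`Encl.primeMeanSq`, `Encl.msCrude`, `Encl.msRes`) with the sine
lower-bound data represented as VALUE-indexed natural lists (`Encl.sFun sd cs k = sd[k]·2^{−cs}`, `Encl.sFun2`), so that every door
sum over `weilPrimeIndex a` is a list sum over the prime data (`Encl.sum_weilPrimeIndex_eq_listSum`) and the kernel looks the datum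
up the same way (`x / 0 = 0` realises the «crude» convention).  Everything is proved; no named facts.
-/

open Real Complex Finset Matrix
open scoped BigOperators

namespace Literature.NumberTheory.LFunctions.Yoshida1992

open Literature.Analysis.SpecialFunctions Literature.Analysis.ValidatedNumerics.NumericsMP
open Literature.Analysis.ValidatedNumerics
open scoped ArithmeticFunction.vonMangoldt

namespace Encl

variable {S : ℕ} {a : ℝ} {ks : List PrimeLen} {C : Consts}

/-! ## Value-indexed sine data -/

/-- `s(k) = sd[k]·2^{−cs}` (value-indexed list; `0` off the list). [cite: Moore1966, Ch. 3 (interval arithmetic: inclusion property)] -/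
noncomputable def sFun (sd : List ℕ) (cs : ℕ) : ℕ → ℝ := fun k ↦ ((sd.getD k 0 : ℕ) : ℝ) * (1 / 2 ^ cs)

/-- `s(k,k') = sd[k][k']·2^{−cs}`. [cite: Moore1966, Ch. 3 (interval arithmetic: inclusion property)] -/
noncomputable def sFun2 (sd : List (List ℕ)) (cs : ℕ) : ℕ → ℕ → ℝ :=
  fun k k' ↦ (((sd.getD k []).getD k' 0 : ℕ) : ℝ) * (1 / 2 ^ cs)

/-- [cite: Moore1966, Ch. 3 (interval arithmetic: inclusion property)] -/
theorem sFun_eq_zero_iff {sd : List ℕ} {cs k : ℕ} : sFun sd cs k = 0 ↔ sd.getD k 0 = 0 := by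
  unfold sFun
  constructor
  · intro h
    have h2 : (1 : ℝ) / 2 ^ cs ≠ 0 := by positivity
    have := (mul_eq_zero.mp h).resolve_right h2
    exact_mod_cast this
  · intro h
    rw [h]; simp

/-- [cite: Moore1966, Ch. 3 (interval arithmetic: inclusion property)] -/
theorem sFun2_eq_zero_iff {sd : List (List ℕ)} {cs k k' : ℕ} : sFun2 sd cs k k' = 0 ↔ (sd.getD k []).getD k' 0 = 0 := by
  unfold sFun2
  constructor
  · intro h
    have h2 : (1 : ℝ) / 2 ^ cs ≠ 0 := by positivity
    have := (mul_eq_zero.mp h).resolve_right h2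
    exact_mod_cast this
  · intro h
    rw [h]; simp

/-! ## One-variable prime sums `Σ_k (Λ_k/√k)·g(k)` as list sums, and their boxes -/

/-- The list form of a weighted prime sum, indexed by position. [cite: Yoshida1992HermitianForms, §5 (5.15) p. 301] -/
theorem sum_weilPrimeIndex_eq_sum_range (hks : PrimeData a ks) (g : ℕ → ℝ) :
    ∑ k ∈ weilPrimeIndex a, (Λ k : ℝ) / Real.sqrt k * g k
      = ∑ q ∈ Finset.range ks.length, (ks.getD q default).wt * g (ks.getD q default).val := by
  rw [sum_weilPrimeIndex_eq_listSum hks, list_sum_map_eq_sum_range]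

/-- Box of `Σ_q wts_q · G_q` for a box family `G`. [cite: Moore1966, Ch. 3 (interval arithmetic: inclusion property)] -/
def wSumBox (S : ℕ) (wts : List MI) (G : ℕ → MI) (n : ℕ) : MI := sumBox S (fun q ↦ (wts.getD q default).mul S (G q)) n

/-- [cite: Moore1966, Ch. 3 (interval arithmetic: inclusion property)] -/
theorem mem_wSumBox (hS : 0 < S) (hks : PrimeData a ks) (hC : ConstsValid S a ks C) {g : ℕ → ℝ} {G : ℕ → MI}
    (hG : ∀ q < ks.length, MI.mem S (g (ks.getD q default).val) (G q)) :
    MI.mem S (∑ k ∈ weilPrimeIndex a, (Λ k : ℝ) / Real.sqrt k * g k) (wSumBox S C.wts G ks.length) := by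
  rw [sum_weilPrimeIndex_eq_sum_range hks]
  exact mem_sumBox S ks.length fun q hq ↦ MI.mem_mul hS (hC.wts q hq) (hG q hq)

/-- `Σ_k (Λ_k/√k)²`. [cite: Moore1966, Ch. 3 (interval arithmetic: inclusion property)] -/
def primeMeanSqBox (S : ℕ) (C : Consts) (nks : ℕ) : MI := wSumBox S C.wts (fun q ↦ C.wts.getD q default) nks

/-- [cite: Moore1966, Ch. 3 (interval arithmetic: inclusion property)] -/
theorem mem_primeMeanSqBox (hS : 0 < S) (hks : PrimeData a ks) (hC : ConstsValid S a ks C) :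
    MI.mem S (primeMeanSq a) (primeMeanSqBox S C ks.length) := by
  unfold primeMeanSq primeMeanSqBox
  have e : ∑ k ∈ weilPrimeIndex a, ((Λ k : ℝ) / Real.sqrt k) ^ 2
      = ∑ k ∈ weilPrimeIndex a, (Λ k : ℝ) / Real.sqrt k * ((Λ k : ℝ) / Real.sqrt k) :=
    Finset.sum_congr rfl fun k _ ↦ by ring
  rw [e]
  refine mem_wSumBox hS hks hC (g := fun k ↦ (Λ k : ℝ) / Real.sqrt k) fun q hq ↦ ?_
  have hq' : (ks.getD q default) ∈ ks := by
    rw [List.getD_eq_getElem?_getD, List.getElem?_eq_getElem hq]; exact List.getElem_mem hq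
  rw [PrimeLen.vonMangoldt_div_sqrt_val (hks.prime _ hq')]
  exact hC.wts q hq

/-- `Σ_k [s₁ k = 0] Λ_k/√k` with `s₁ = sFun sd cs`. [cite: Moore1966, Ch. 3 (interval arithmetic: inclusion property)] -/
def crude1Box (S : ℕ) (C : Consts) (ks : List PrimeLen) (sd : List ℕ) : MI :=
  wSumBox S C.wts (fun q ↦ if sd.getD (ks.getD q default).val 0 = 0 then MI.ofInt S 1 else MI.ofInt S 0) ks.length

/-- [cite: Moore1966, Ch. 3 (interval arithmetic: inclusion property)] -/
theorem mem_crude1Box (hS : 0 < S) (hks : PrimeData a ks) (hC : ConstsValid S a ks C) (sd : List ℕ) (cs : ℕ) :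
    MI.mem S (∑ k ∈ weilPrimeIndex a, if sFun sd cs k = 0 then (Λ k : ℝ) / Real.sqrt k else 0) (crude1Box S C ks sd) := by
  unfold crude1Box
  have e : ∑ k ∈ weilPrimeIndex a, (if sFun sd cs k = 0 then (Λ k : ℝ) / Real.sqrt k else 0)
      = ∑ k ∈ weilPrimeIndex a, (Λ k : ℝ) / Real.sqrt k * (if sFun sd cs k = 0 then 1 else 0) :=
    Finset.sum_congr rfl fun k _ ↦ by split_ifs <;> simp
  rw [e]
  refine mem_wSumBox hS hks hC (g := fun k ↦ if sFun sd cs k = 0 then (1 : ℝ) else 0) fun q _ ↦ ?_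
  simp only [sFun_eq_zero_iff]
  split_ifs
  · simpa using MI.mem_ofInt S 1
  · simpa using MI.mem_ofInt S 0

/-- `Σ_k Λ_k/√k / s₁ k` with `s₁ = sFun sd cs` (`x/0 = 0`). [cite: Moore1966, Ch. 3 (interval arithmetic: inclusion property)] -/
def res1Box (S : ℕ) (C : Consts) (ks : List PrimeLen) (sd : List ℕ) (cs : ℕ) : MI :=
  wSumBox S C.wts (fun q ↦ let z := sd.getD (ks.getD q default).val 0
    if z = 0 then MI.ofInt S 0 else ((MI.ofInt S 1).mulInt (2 ^ cs)).divNat z) ks.length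

/-- [cite: Moore1966, Ch. 3 (interval arithmetic: inclusion property)] -/
theorem mem_res1Box (hS : 0 < S) (hks : PrimeData a ks) (hC : ConstsValid S a ks C) (sd : List ℕ) (cs : ℕ) :
    MI.mem S (∑ k ∈ weilPrimeIndex a, (Λ k : ℝ) / Real.sqrt k / sFun sd cs k) (res1Box S C ks sd cs) := by
  unfold res1Box
  have e : ∑ k ∈ weilPrimeIndex a, (Λ k : ℝ) / Real.sqrt k / sFun sd cs k
      = ∑ k ∈ weilPrimeIndex a, (Λ k : ℝ) / Real.sqrt k * (1 / sFun sd cs k) :=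
    Finset.sum_congr rfl fun k _ ↦ by ring
  rw [e]
  refine mem_wSumBox hS hks hC (g := fun k ↦ 1 / sFun sd cs k) fun q _ ↦ ?_
  simp only
  split_ifs with hz
  · have : sFun sd cs (ks.getD q default).val = 0 := sFun_eq_zero_iff.mpr hz
    rw [this]; simpa using MI.mem_ofInt S 0
  · have h := MI.mem_divNat (MI.mem_mulInt (MI.mem_ofInt S 1) (2 ^ cs)) (n := sd.getD (ks.getD q default).val 0) (by omega)
    refine mem_of_eq h ?_
    unfold sFun
    have hz' : ((sd.getD (ks.getD q default).val 0 : ℕ) : ℝ) ≠ 0 := by exact_mod_cast hz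
    push_cast
    field_simp

/-! ## Two-variable prime sums (crude pairs and resonance pairs) -/

/-- `Σ_k Σ_{k'} (if s k k' = 0 then w_k w_k' else 0)` as `Σ_k w_k · Σ_{k'} w_k'·[s k k' = 0]`. [cite: Yoshida1992HermitianForms, §7 pp. 305–312] -/
theorem sum_sum_ite_mul_eq (s : ℕ → ℕ → ℝ) (T : Finset ℕ) (w : ℕ → ℝ) :
    ∑ k ∈ T, ∑ k' ∈ T, (if s k k' = 0 then w k * w k' else 0)
      = ∑ k ∈ T, w k * ∑ k' ∈ T, w k' * (if s k k' = 0 then (1 : ℝ) else 0) := by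
  refine Finset.sum_congr rfl fun k _ ↦ ?_
  rw [Finset.mul_sum]
  refine Finset.sum_congr rfl fun k' _ ↦ ?_
  split_ifs <;> simp

/-- `Σ_k Σ_{k'} w_k w_k'/s k k'` as `Σ_k w_k · Σ_{k'} w_k'·(1/s k k')`. [cite: Yoshida1992HermitianForms, §7 pp. 305–312] -/
theorem sum_sum_div_eq (s : ℕ → ℕ → ℝ) (T : Finset ℕ) (w : ℕ → ℝ) :
    ∑ k ∈ T, ∑ k' ∈ T, w k * w k' / s k k' = ∑ k ∈ T, w k * ∑ k' ∈ T, w k' * (1 / s k k') := by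
  refine Finset.sum_congr rfl fun k _ ↦ ?_
  rw [Finset.mul_sum]
  exact Finset.sum_congr rfl fun k' _ ↦ by ring

/-- The `erase` double sum is the full one minus the diagonal. [cite: Yoshida1992HermitianForms, §7 pp. 305–312] -/
theorem sum_sum_erase_eq (T : Finset ℕ) (f : ℕ → ℕ → ℝ) :
    ∑ k ∈ T, ∑ k' ∈ T.erase k, f k k' = ∑ k ∈ T, ∑ k' ∈ T, f k k' - ∑ k ∈ T, f k k := by
  rw [← Finset.sum_sub_distrib]
  exact Finset.sum_congr rfl fun k hk ↦ Finset.sum_erase_eq_sub hk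

/-- Box of `Σ_k w_k Σ_{k'} w_k' · G(k,k')` for a box family `G q q'` (positions). [cite: Moore1966, Ch. 3 (interval arithmetic: inclusion property)] -/
def wSum2Box (S : ℕ) (wts : List MI) (G : ℕ → ℕ → MI) (n : ℕ) : MI :=
  wSumBox S wts (fun q ↦ wSumBox S wts (G q) n) n

/-- [cite: Moore1966, Ch. 3 (interval arithmetic: inclusion property)] -/
theorem mem_wSum2Box (hS : 0 < S) (hks : PrimeData a ks) (hC : ConstsValid S a ks C) {g : ℕ → ℕ → ℝ} {G : ℕ → ℕ → MI}
    (hG : ∀ q < ks.length, ∀ q' < ks.length, MI.mem S (g (ks.getD q default).val (ks.getD q' default).val) (G q q')) :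
    MI.mem S (∑ k ∈ weilPrimeIndex a, (Λ k : ℝ) / Real.sqrt k * ∑ k' ∈ weilPrimeIndex a, (Λ k' : ℝ) / Real.sqrt k' * g k k')
      (wSum2Box S C.wts G ks.length) :=
  mem_wSumBox hS hks hC (g := fun k ↦ ∑ k' ∈ weilPrimeIndex a, (Λ k' : ℝ) / Real.sqrt k' * g k k')
    fun q hq ↦ mem_wSumBox hS hks hC (g := fun k' ↦ g (ks.getD q default).val k') fun q' hq' ↦ hG q hq q' hq'

/-- datum box `[s(k,k') = 0]` (as `1`/`0`). [cite: Moore1966, Ch. 3 (interval arithmetic: inclusion property)] -/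
def iteZeroBox (S : ℕ) (z : ℕ) : MI := if z = 0 then MI.ofInt S 1 else MI.ofInt S 0

/-- [cite: Moore1966, Ch. 3 (interval arithmetic: inclusion property)] -/
theorem mem_iteZeroBox (S : ℕ) {x : ℝ} {z : ℕ} (h : x = 0 ↔ z = 0) :
    MI.mem S (if x = 0 then (1 : ℝ) else 0) (iteZeroBox S z) := by
  unfold iteZeroBox
  by_cases hz : z = 0
  · rw [if_pos (h.mpr hz), if_pos hz]; simpa using MI.mem_ofInt S 1
  · rw [if_neg (fun hx ↦ hz (h.mp hx)), if_neg hz]; simpa using MI.mem_ofInt S 0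

/-- datum box `1/s` with `s = z·2^{−cs}` (`1/0 = 0`). [cite: Moore1966, Ch. 3 (interval arithmetic: inclusion property)] -/
def invDatBox (S : ℕ) (cs z : ℕ) : MI := if z = 0 then MI.ofInt S 0 else ((MI.ofInt S 1).mulInt (2 ^ cs)).divNat z

/-- [cite: Moore1966, Ch. 3 (interval arithmetic: inclusion property)] -/
theorem mem_invDatBox (S : ℕ) (cs z : ℕ) : MI.mem S (1 / (((z : ℕ) : ℝ) * (1 / 2 ^ cs))) (invDatBox S cs z) := by
  unfold invDatBox
  by_cases hz : z = 0
  · rw [if_pos hz, hz]; simpa using MI.mem_ofInt S 0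
  · rw [if_neg hz]
    have h := MI.mem_divNat (MI.mem_mulInt (MI.mem_ofInt S 1) (2 ^ cs)) (n := z) (by omega)
    refine mem_of_eq h ?_
    have hz' : ((z : ℕ) : ℝ) ≠ 0 := by exact_mod_cast hz
    push_cast
    field_simp

/-- `Σ_k Σ_{k'} [sp = 0] w_k w_k'` (value-indexed pair data `sd`). [cite: Moore1966, Ch. 3 (interval arithmetic: inclusion property)] -/
def crude2Box (S : ℕ) (C : Consts) (ks : List PrimeLen) (sd : List (List ℕ)) : MI :=
  wSum2Box S C.wts (fun q q' ↦ iteZeroBox S ((sd.getD (ks.getD q default).val []).getD (ks.getD q' default).val 0)) ks.length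

/-- [cite: Moore1966, Ch. 3 (interval arithmetic: inclusion property)] -/
theorem mem_crude2Box (hS : 0 < S) (hks : PrimeData a ks) (hC : ConstsValid S a ks C) (sd : List (List ℕ)) (cs : ℕ) :
    MI.mem S (∑ k ∈ weilPrimeIndex a, ∑ k' ∈ weilPrimeIndex a,
        if sFun2 sd cs k k' = 0 then (Λ k : ℝ) / Real.sqrt k * ((Λ k' : ℝ) / Real.sqrt k') else 0) (crude2Box S C ks sd) := by
  rw [sum_sum_ite_mul_eq]
  exact mem_wSum2Box hS hks hC (g := fun k k' ↦ if sFun2 sd cs k k' = 0 then (1 : ℝ) else 0)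
    fun q _ q' _ ↦ mem_iteZeroBox S sFun2_eq_zero_iff

/-- the diagonal `Σ_k [s(k,k) = 0] w_k²`. [cite: Moore1966, Ch. 3 (interval arithmetic: inclusion property)] -/
def crudeDiagBox (S : ℕ) (C : Consts) (ks : List PrimeLen) (sd : List (List ℕ)) : MI :=
  wSumBox S C.wts (fun q ↦ (C.wts.getD q default).mul S
    (iteZeroBox S ((sd.getD (ks.getD q default).val []).getD (ks.getD q default).val 0))) ks.length

/-- [cite: Moore1966, Ch. 3 (interval arithmetic: inclusion property)] -/
theorem mem_crudeDiagBox (hS : 0 < S) (hks : PrimeData a ks) (hC : ConstsValid S a ks C) (sd : List (List ℕ)) (cs : ℕ) :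
    MI.mem S (∑ k ∈ weilPrimeIndex a,
        if sFun2 sd cs k k = 0 then (Λ k : ℝ) / Real.sqrt k * ((Λ k : ℝ) / Real.sqrt k) else 0) (crudeDiagBox S C ks sd) := by
  unfold crudeDiagBox
  have e : ∑ k ∈ weilPrimeIndex a, (if sFun2 sd cs k k = 0 then (Λ k : ℝ) / Real.sqrt k * ((Λ k : ℝ) / Real.sqrt k) else 0)
      = ∑ k ∈ weilPrimeIndex a, (Λ k : ℝ) / Real.sqrt k * ((Λ k : ℝ) / Real.sqrt k * (if sFun2 sd cs k k = 0 then 1 else 0)) :=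
    Finset.sum_congr rfl fun k _ ↦ by split_ifs <;> simp
  rw [e]
  refine mem_wSumBox hS hks hC (g := fun k ↦ (Λ k : ℝ) / Real.sqrt k * (if sFun2 sd cs k k = 0 then (1 : ℝ) else 0)) fun q hq ↦ ?_
  have hq' : (ks.getD q default) ∈ ks := by
    rw [List.getD_eq_getElem?_getD, List.getElem?_eq_getElem hq]; exact List.getElem_mem hq
  rw [PrimeLen.vonMangoldt_div_sqrt_val (hks.prime _ hq')]
  exact MI.mem_mul hS (hC.wts q hq) (mem_iteZeroBox S sFun2_eq_zero_iff)

/-- `Σ_k Σ_{k' ≠ k} [sm = 0] w_k w_k'` (the `erase` sum). [cite: Moore1966, Ch. 3 (interval arithmetic: inclusion property)] -/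
def crude2EraseBox (S : ℕ) (C : Consts) (ks : List PrimeLen) (sd : List (List ℕ)) : MI :=
  (crude2Box S C ks sd).sub (crudeDiagBox S C ks sd)

/-- [cite: Moore1966, Ch. 3 (interval arithmetic: inclusion property)] -/
theorem mem_crude2EraseBox (hS : 0 < S) (hks : PrimeData a ks) (hC : ConstsValid S a ks C) (sd : List (List ℕ)) (cs : ℕ) :
    MI.mem S (∑ k ∈ weilPrimeIndex a, ∑ k' ∈ (weilPrimeIndex a).erase k,
        if sFun2 sd cs k k' = 0 then (Λ k : ℝ) / Real.sqrt k * ((Λ k' : ℝ) / Real.sqrt k') else 0) (crude2EraseBox S C ks sd) := by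
  unfold crude2EraseBox
  rw [sum_sum_erase_eq]
  exact MI.mem_sub (mem_crude2Box hS hks hC sd cs) (mem_crudeDiagBox hS hks hC sd cs)

/-- `Σ_k Σ_{k'} w_k w_k'/sp(k,k')`. [cite: Moore1966, Ch. 3 (interval arithmetic: inclusion property)] -/
def res2Box (S : ℕ) (C : Consts) (ks : List PrimeLen) (sd : List (List ℕ)) (cs : ℕ) : MI :=
  wSum2Box S C.wts (fun q q' ↦ invDatBox S cs ((sd.getD (ks.getD q default).val []).getD (ks.getD q' default).val 0)) ks.length

/-- [cite: Moore1966, Ch. 3 (interval arithmetic: inclusion property)] -/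
theorem mem_res2Box (hS : 0 < S) (hks : PrimeData a ks) (hC : ConstsValid S a ks C) (sd : List (List ℕ)) (cs : ℕ) :
    MI.mem S (∑ k ∈ weilPrimeIndex a, ∑ k' ∈ weilPrimeIndex a,
        (Λ k : ℝ) / Real.sqrt k * ((Λ k' : ℝ) / Real.sqrt k') / sFun2 sd cs k k') (res2Box S C ks sd cs) := by
  rw [sum_sum_div_eq]
  exact mem_wSum2Box hS hks hC (g := fun k k' ↦ 1 / sFun2 sd cs k k') fun q _ q' _ ↦ mem_invDatBox S cs _

/-- the diagonal `Σ_k w_k²/s(k,k)`. [cite: Moore1966, Ch. 3 (interval arithmetic: inclusion property)] -/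
def resDiagBox (S : ℕ) (C : Consts) (ks : List PrimeLen) (sd : List (List ℕ)) (cs : ℕ) : MI :=
  wSumBox S C.wts (fun q ↦ (C.wts.getD q default).mul S
    (invDatBox S cs ((sd.getD (ks.getD q default).val []).getD (ks.getD q default).val 0))) ks.length

/-- [cite: Moore1966, Ch. 3 (interval arithmetic: inclusion property)] -/
theorem mem_resDiagBox (hS : 0 < S) (hks : PrimeData a ks) (hC : ConstsValid S a ks C) (sd : List (List ℕ)) (cs : ℕ) :
    MI.mem S (∑ k ∈ weilPrimeIndex a, (Λ k : ℝ) / Real.sqrt k * ((Λ k : ℝ) / Real.sqrt k) / sFun2 sd cs k k)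
      (resDiagBox S C ks sd cs) := by
  unfold resDiagBox
  have e : ∑ k ∈ weilPrimeIndex a, (Λ k : ℝ) / Real.sqrt k * ((Λ k : ℝ) / Real.sqrt k) / sFun2 sd cs k k
      = ∑ k ∈ weilPrimeIndex a, (Λ k : ℝ) / Real.sqrt k * ((Λ k : ℝ) / Real.sqrt k * (1 / sFun2 sd cs k k)) :=
    Finset.sum_congr rfl fun k _ ↦ by ring
  rw [e]
  refine mem_wSumBox hS hks hC (g := fun k ↦ (Λ k : ℝ) / Real.sqrt k * (1 / sFun2 sd cs k k)) fun q hq ↦ ?_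
  have hq' : (ks.getD q default) ∈ ks := by
    rw [List.getD_eq_getElem?_getD, List.getElem?_eq_getElem hq]; exact List.getElem_mem hq
  rw [PrimeLen.vonMangoldt_div_sqrt_val (hks.prime _ hq')]
  exact MI.mem_mul hS (hC.wts q hq) (mem_invDatBox S cs _)

/-- `Σ_k Σ_{k' ≠ k} w_k w_k'/sm(k,k')` (the `erase` sum). [cite: Moore1966, Ch. 3 (interval arithmetic: inclusion property)] -/
def res2EraseBox (S : ℕ) (C : Consts) (ks : List PrimeLen) (sd : List (List ℕ)) (cs : ℕ) : MI :=
  (res2Box S C ks sd cs).sub (resDiagBox S C ks sd cs)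

/-- [cite: Moore1966, Ch. 3 (interval arithmetic: inclusion property)] -/
theorem mem_res2EraseBox (hS : 0 < S) (hks : PrimeData a ks) (hC : ConstsValid S a ks C) (sd : List (List ℕ)) (cs : ℕ) :
    MI.mem S (∑ k ∈ weilPrimeIndex a, ∑ k' ∈ (weilPrimeIndex a).erase k,
        (Λ k : ℝ) / Real.sqrt k * ((Λ k' : ℝ) / Real.sqrt k') / sFun2 sd cs k k') (res2EraseBox S C ks sd cs) := by
  unfold res2EraseBox
  rw [sum_sum_erase_eq]
  exact MI.mem_sub (mem_res2Box hS hks hC sd cs) (mem_resDiagBox hS hks hC sd cs)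

/-! ## The mean-square constant and the resonance radius -/

/-- box of `msCrude a (sFun sd1 cs) (sFun2 sdm cs) (sFun2 sdp cs)`. [cite: Moore1966, Ch. 3 (interval arithmetic: inclusion property)] -/
def msCrudeBox (S : ℕ) (C : Consts) (ks : List PrimeLen) (sd1 : List ℕ) (sdm sdp : List (List ℕ)) : MI :=
  (((C.P.divNat 2).mul S (crude1Box S C ks sd1)).add ((crude2EraseBox S C ks sdm).divNat 2)).add ((crude2Box S C ks sdp).divNat 2)

/-- [cite: Moore1966, Ch. 3 (interval arithmetic: inclusion property)] -/
theorem mem_msCrudeBox (hS : 0 < S) (hks : PrimeData a ks) (hC : ConstsValid S a ks C) (sd1 : List ℕ) (sdm sdp : List (List ℕ))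
    (cs : ℕ) : MI.mem S (msCrude a (sFun sd1 cs) (sFun2 sdm cs) (sFun2 sdp cs)) (msCrudeBox S C ks sd1 sdm sdp) := by
  unfold msCrude msCrudeBox
  have h := MI.mem_add (MI.mem_add (MI.mem_mul hS (MI.mem_divNat hC.pi (n := 2) (by norm_num)) (mem_crude1Box hS hks hC sd1 cs))
    (MI.mem_divNat (mem_crude2EraseBox hS hks hC sdm cs) (n := 2) (by norm_num)))
    (MI.mem_divNat (mem_crude2Box hS hks hC sdp cs) (n := 2) (by norm_num))
  refine mem_of_eq h ?_
  push_cast; ring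

/-- box of `msRes`. [cite: Moore1966, Ch. 3 (interval arithmetic: inclusion property)] -/
def msResBox (S : ℕ) (C : Consts) (ks : List PrimeLen) (sd1 : List ℕ) (sdm sdp : List (List ℕ)) (cs : ℕ) : MI :=
  (((C.P.divNat 2).mul S (res1Box S C ks sd1 cs)).add ((res2EraseBox S C ks sdm cs).divNat 2)).add ((res2Box S C ks sdp cs).divNat 2)

/-- [cite: Moore1966, Ch. 3 (interval arithmetic: inclusion property)] -/
theorem mem_msResBox (hS : 0 < S) (hks : PrimeData a ks) (hC : ConstsValid S a ks C) (sd1 : List ℕ) (sdm sdp : List (List ℕ))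
    (cs : ℕ) : MI.mem S (msRes a (sFun sd1 cs) (sFun2 sdm cs) (sFun2 sdp cs)) (msResBox S C ks sd1 sdm sdp cs) := by
  unfold msRes msResBox
  have h := MI.mem_add (MI.mem_add (MI.mem_mul hS (MI.mem_divNat hC.pi (n := 2) (by norm_num)) (mem_res1Box hS hks hC sd1 cs))
    (MI.mem_divNat (mem_res2EraseBox hS hks hC sdm cs) (n := 2) (by norm_num)))
    (MI.mem_divNat (mem_res2Box hS hks hC sdp cs) (n := 2) (by norm_num))
  refine mem_of_eq h ?_
  push_cast; ring

/-- box of `msConst a Y …` (`F.Ca ∋ a(1+E)`, `F.A1 ∋ A₁`). [cite: Moore1966, Ch. 3 (interval arithmetic: inclusion property)] -/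
def msConstBox (S : ℕ) (C : Consts) (F : FDConsts) (ks : List PrimeLen) (Y : ℕ) (sd1 : List ℕ) (sdm sdp : List (List ℕ)) : MI :=
  let edge := (F.Ca.mul S C.invPi).divNat Y
  ((((C.P.divNat 4).add edge).sqr S).add ((primeMeanSqBox S C ks.length).divNat 2)).add
    (((edge.mulInt 2).mul S F.A1).add (msCrudeBox S C ks sd1 sdm sdp))

/-- [cite: Moore1966, Ch. 3 (interval arithmetic: inclusion property)] -/
theorem mem_msConstBox (hS : 0 < S) (hks : PrimeData a ks) (hC : ConstsValid S a ks C) {F : FDConsts} (hF : FDValid S a F)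
    {Y : ℕ} (hY : 0 < Y) (sd1 : List ℕ) (sdm sdp : List (List ℕ)) (cs : ℕ) :
    MI.mem S (msConst a Y (sFun sd1 cs) (sFun2 sdm cs) (sFun2 sdp cs)) (msConstBox S C F ks Y sd1 sdm sdp) := by
  unfold msConst msConstBox
  have hedge : MI.mem S (a * (1 + weilArchDensity (2 * a)) / (π * Y)) ((F.Ca.mul S C.invPi).divNat Y) := by
    have h := MI.mem_divNat (MI.mem_mul hS hF.Ca hC.invPi) hY
    refine mem_of_eq h ?_
    have hπ : (π : ℝ) ≠ 0 := Real.pi_ne_zero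
    have hY' : (Y : ℝ) ≠ 0 := by exact_mod_cast hY.ne'
    field_simp
  have h := MI.mem_add (MI.mem_add (MI.mem_sqr hS (MI.mem_add (MI.mem_divNat hC.pi (n := 4) (by norm_num)) hedge))
    (MI.mem_divNat (mem_primeMeanSqBox hS hks hC) (n := 2) (by norm_num)))
    (MI.mem_add (MI.mem_mul hS (MI.mem_mulInt hedge 2) hF.A1) (mem_msCrudeBox hS hks hC sd1 sdm sdp cs))
  refine mem_of_eq h ?_
  unfold primeMass
  push_cast; ring

end Encl

end Literature.NumberTheory.LFunctions.Yoshida1992
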